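import Summits.ResolutionOfSingularities.ResolutionOfSingularities.Theorems.DescentDescentPerfectToAllPerfectCoreResidual
import HarnessLib

/-!
# `DescentPerfectToAll` (stmt-ResolutionOfSingularities-0549): fields of FINITE `p`-RANK, and schemes defined over a
# perfect field

Route `ResolutionOfSingularities/Descent`, crux `DescentPerfectToAll`. Helper (OURS; not a statement of any
manuscript; `--supports` the crux, does not close it). Two capstones of the perfect-core layer
(`DescentDescentPerfectToAllPerfectCore*.lean`):

* `exhaustedByEssFiniteType_iff_trdeg_le_of_pRank` — **for a field of finite `p`-rank `r`** (`r` `p`-independent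
  elements, and every `K^p`-free finite family has `≤ p^r` members) **with perfect core `P₀`: `K` is EFT-separably
  exhausted iff `tr.deg_{P₀} K ≤ r`** (then `= r`). So among fields of finite `p`-rank — which include every kernel
  inhabitant of the residual so far (`𝔽_p((X))`, `p`-rank `1`, and its countable hulls) — the residual class of the
  crux (`descentPerfectToAll_iff_residual`) is exactly «transcendence degree over the perfect core exceeds the
  `p`-rank» (possibly infinite), and its complement is covered
  (`hasResolution_of_perfectRes_of_pIndependent_of_trdeg_le`).
* `linearIndepOn_pow_of_perfectField`, `hasResolution_of_perfectRes_of_definedOver_perfectField` — **schemes defined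
  over a perfect field have resolutions over EVERY ground field** (given `PerfectRes p`): if `k₀` is perfect and `k ⊇ k₀`
  is any field, `X₀ ×_{k₀} k` has a resolution for every reduced separated `X₀` of finite type over `k₀`, because
  `k / k₀` satisfies Mac Lane's criterion trivially and resolutions ascend along Mac Lane-separable extensions
  (`hasResolution_pullback_of_linearIndepOn_pow`). This is a class of SCHEMES over residual ground fields (e.g. every
  constant-field extension `X₀ ×_{𝔽_p} 𝔽_p((t))`) on which the crux's conclusion holds although the ground field itself
  is not EFT-separably exhausted.

[cite: Matsumura1987, Thm. 26.5 and Thm. 26.8; EGAIV2, Prop. 6.7.4] [folklore]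
-/

noncomputable section

set_option linter.dupNamespace false -- mandated namespace of this single-conjunct summit

open CategoryTheory CategoryTheory.Limits AlgebraicGeometry
open Literature.AlgebraicGeometry.Resolution

namespace Summit.ResolutionOfSingularities.ResolutionOfSingularities.Theorems

variable {p : ℕ} [Fact p.Prime] {K : Type} [Field K] [CharP K p]

/-! ## Finite `p`-rank: exhausted iff the transcendence degree over the perfect core is the `p`-rank -/

variable (p) in
/-- **Finite `p`-rank `r`: EFT-separably exhausted ⟺ `tr.deg_{P₀} K ≤ r`.** Let `K` have characteristic `p`,
perfect core `P` (perfect, containing every image of a perfect field), `r` `p`-independent elements `t₁, …, t_r`, and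
suppose every `K^p`-linearly independent finite family has at most `p^r` members. Then `K` is EFT-separably exhausted
iff `Algebra.trdeg P K ≤ r`: `⇐` by `exhaustedByEssFiniteType_of_pIndependent_of_trdeg_le` (then `t` is a
transcendence basis); `⇒` because `tr.deg_P K > r` supplies `r + 1` algebraically independent elements and
`not_exhaustedByEssFiniteType_of_pRank_le_of_perfectCore` applies. [cite: Matsumura1987, Thm. 26.5 and Thm. 26.8] -/
theorem exhaustedByEssFiniteType_iff_trdeg_le_of_pRank (P : Subfield K) (hP : ∀ x ∈ P, ∃ y ∈ P, y ^ p = x)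
    (hcore : ∀ (k₀ : Type) [Field k₀] [PerfectField k₀] (φ : k₀ →+* K) (a : k₀), φ a ∈ P)
    {r : ℕ} (t : Fin r → K)
    (ht : ∀ e : (Fin r → Fin p) → K, ∑ α, (∏ i, t i ^ (α i : ℕ)) * e α ^ p = 0 → ∀ α, e α = 0)
    (hrank : ∀ (m : ℕ) (v : Fin m → K), LinearIndependent (frobenius K p).fieldRange v → m ≤ p ^ r) :
    (∀ s : Finset K, ∃ (k₀ : Type) (_ : Field k₀) (_ : PerfectField k₀)
      (E : Subfield K) (_ : Algebra k₀ E), Algebra.EssFiniteType k₀ E ∧ (↑s : Set K) ⊆ E ∧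
        ∀ u : Finset K, LinearIndepOn E _root_.id (↑u : Set K) →
          LinearIndepOn E (fun y : K => y ^ p) (↑u : Set K)) ↔
    Algebra.trdeg P K ≤ r := by
  classical
  constructor
  · intro hk
    by_contra hlt
    rw [not_le] at hlt
    -- `r + 1` algebraically independent elements over `P`
    obtain ⟨b, hb⟩ := exists_isTranscendenceBasis P K
    have hcard : Cardinal.mk (Fin (r + 1)) ≤ Cardinal.mk ↥b := by
      rw [hb.cardinalMk_eq_trdeg, Cardinal.mk_fin, Nat.cast_succ, ← Cardinal.succ_natCast]
      exact Order.succ_le_of_lt hlt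
    rw [Cardinal.le_def] at hcard
    obtain ⟨emb⟩ := hcard
    have hind : AlgebraicIndependent P ((Subtype.val : ↥b → K) ∘ emb) := hb.1.comp _ emb.injective
    exact not_exhaustedByEssFiniteType_of_pRank_le_of_perfectCore p r hrank P hcore _ hind
      (by rw [Fintype.card_fin]) hk
  · intro htr
    exact exhaustedByEssFiniteType_of_pIndependent_of_trdeg_le P hP t ht htr

/-! ## Schemes defined over a perfect field, over any ground field -/

omit [CharP K p] in
variable (p) in
/-- **Mac Lane's criterion is automatic over a perfect field**: if `k₀` is perfect of characteristic `p` and `k` is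
any extension field, `k₀`-linearly independent finite families in `k` have `k₀`-linearly independent `p`-th powers
(a relation `∑ cᵢ xᵢ^p = 0` with `cᵢ = dᵢ^p ∈ k₀` is `(∑ dᵢ xᵢ)^p = 0`). [folklore] -/
theorem linearIndepOn_pow_of_perfectField (k₀ : Type) [Field k₀] [PerfectField k₀] [CharP k₀ p]
    [Algebra k₀ K] (u : Finset K) (hu : LinearIndepOn k₀ _root_.id (↑u : Set K)) :
    LinearIndepOn k₀ (fun x : K => x ^ p) (↑u : Set K) := by
  classical
  have hp : p.Prime := Fact.out
  haveI : ExpChar k₀ p := ExpChar.prime hp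
  haveI : CharP K p := charP_of_injective_algebraMap (algebraMap k₀ K).injective p
  haveI : ExpChar K p := ExpChar.prime hp
  haveI : PerfectRing k₀ p := PerfectField.toPerfectRing p
  rw [LinearIndepOn, linearIndependent_iff'] at hu ⊢
  intro s g hg i hi
  -- `p`-th roots of the coefficients
  set d : ↥(↑u : Set K) → k₀ := fun j => (frobeniusEquiv k₀ p).symm (g j) with hd
  have hdg : ∀ j, d j ^ p = g j := fun j => by
    rw [hd, ← frobenius_def, ← frobeniusEquiv_apply, RingEquiv.apply_symm_apply]
  have hrel : (∑ j ∈ s, d j • _root_.id (j : K)) ^ p = 0 := by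
    rw [sum_pow_char]
    rw [← hg]
    refine Finset.sum_congr rfl fun j _ => ?_
    rw [_root_.id, smul_pow, hdg j]
  have hzero : ∑ j ∈ s, d j • _root_.id (j : K) = 0 := (pow_eq_zero_iff hp.ne_zero).mp hrel
  have hdj := hu s d hzero i hi
  rw [← hdg i, hdj, zero_pow hp.ne_zero]

/-- **Resolution over perfect fields ⇒ resolution, over ANY ground field, of schemes defined over a perfect field.**
If `k₀` is a perfect field of characteristic `p`, `k ⊇ k₀` an arbitrary field, and `X₀` a reduced separated
`k₀`-scheme of finite type, then `X₀ ×_{k₀} k` has a resolution (given `PerfectRes p`): resolve `X₀` over `k₀` and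
ascend along `k / k₀`, which satisfies Mac Lane's criterion (`linearIndepOn_pow_of_perfectField`,
`hasResolution_pullback_of_linearIndepOn_pow`). E.g. constant-field extensions `X₀ ×_{𝔽_p} 𝔽_p((t))` — schemes over a
ground field in the residual class of the crux. [cite: EGAIV2, Prop. 6.7.4] -/
theorem hasResolution_of_perfectRes_of_definedOver_perfectField (p : ℕ) [Fact p.Prime]
    (H : ∀ (κ : Type) [Field κ] [CharP κ p] [PerfectField κ] (Z : Scheme.{0}) (h : Z ⟶ Spec (.of κ)),
      IsSeparated h → LocallyOfFiniteType h → QuasiCompact h → IsReduced Z → Scheme.HasResolution Z)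
    (k₀ : Type) [Field k₀] [CharP k₀ p] [PerfectField k₀] (k : Type) [Field k] [Algebra k₀ k]
    {X₀ : Scheme.{0}} (f₀ : X₀ ⟶ Spec (.of k₀)) [IsSeparated f₀] [LocallyOfFiniteType f₀] [QuasiCompact f₀]
    [IsReduced X₀] : Scheme.HasResolution (pullback f₀ (specOfAlgebra k₀ k)) := by
  have hp : p.Prime := Fact.out
  haveI : ExpChar k₀ p := ExpChar.prime hp
  haveI : CharP k p := charP_of_injective_algebraMap (algebraMap k₀ k).injective p
  exact hasResolution_pullback_of_linearIndepOn_pow p hp (linearIndepOn_pow_of_perfectField p k₀)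
    f₀ (H k₀ X₀ f₀ ‹_› ‹_› ‹_› ‹_›)

end Summit.ResolutionOfSingularities.ResolutionOfSingularities.Theorems

end
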